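import Summits.CriticalPhenomena.PercolationContinuityZ3.Theorems.Transplant.SkelWinSeedKit
import Summits.CriticalPhenomena.PercolationContinuityZ3.Theorems.Transplant.SkelHabLevels
import HarnessLib

/-!
# L5.5a-Ω — the seed kit of a window level in the HABITAT window graph `winGraphIn G Ω` (`KitOKHab`, `kitSDataHab`, `shyp_kitHab`)
# and the PADDING of a plain kit (`habPad`, `kitOKHab_pad`): the Ω-twins of the whole kit layer collapse to this one file
# (SHEAR-SCOPE §3.10 (2)–(3); design ruling p3-g5, lane INBOX 2026-08-20 21:53:14Z, amending p3-g4 20:59:42Z)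

builds on p205010 (kernel theorem, internal audit signed; external expert review pending) — nothing in this file uses p205010.
Lane `prim-bschramm`, seat `prim-bschramm-p3` (gen 5); helper file (`--supports stmt-CriticalPhenomena-4575 --as helper`); namespace
`Transplant.SkelI`, `[DecidableEq V]` binder (lane convention p3-g4 2026-08-20 19:11:29Z (3)).

The corridor residue (C) of the generic concentric node explores the habitat graph `Skel.winGraphIn G Ω` (`SkelHabLevels`, p2-g4), whose
level-`j` contacts are `K_hab := ∂^{out}_{winGraphIn G Ω} winLevelIn Φ Ω lo hi j`.  Instead of re-typing the slab / cube kit files over `Ω`,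
a plain kit geometry `κ` of the window `(w₀, R)` (`SkelI.KitOK Φ w₀ R lo hi j rs cS cU κ`, e.g. `kitOK_slabCube`) is PADDED:
`habPad Φ Ω w₀ R lo hi j κ` agrees with `κ` on the PLAIN contacts `K_plain := ∂^{out}_{winGraph G w₀ R} winLevel Φ w₀ R lo hi j` and uses the
far remedy `y = S = U = {inNbrIn x}` (an `Ω`-neighbour with skeleton coordinate in the level box) on the other `Ω`-contacts.  Under the one
hypothesis **`hfull : winLevel Φ w₀ R lo hi j ⊆ Ω`** ("`Ω` is full over the level box below depth `R`"; for the fresh habitat `habΩ` this is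
p2-g4's `Skel.win_subset_habΩ` at `(w₀, R) := (t, E - 3)`) the padded geometry satisfies `KitOKHab` with the SAME constants, with no
arithmetic at all; the padded faces lie at depth `≥ R` from `w₀` (`inNbrIn_not_mem_graphBall`), so the consumer's rim target absorbs them.
§1 `inNbrIn`, `inNbrIn_spec`; §2 `KitOKHab`, `kitSDataHab` (the plain data with `K = K_hab`), **`shyp_kitHab`**; §3 `habPad`, its case lemmas,
`mem_plain_of_mem_graphBall` / **`inNbrIn_not_mem_graphBall`** (an `Ω`-contact within depth `R - 1` of `w₀` is plain), **`kitOKHab_pad`**, `shyp_habPad`.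
[cite: KozmaNitzan2024, §4 Lemma 10, p. 19 (Step III, seeds), p. 21 (U(P)) — the ℤ^d model] [cite: GrimmettPercolation1999, §7.2]
-/

noncomputable section

open scoped Classical

namespace Summit.CriticalPhenomena.PercolationContinuityZ3.Theorems
namespace Transplant
namespace SkelI

open Literature.Probability.Percolation Literature.Probability.LatticeModels SimpleGraph KNLevels
open Literature.Barriers.CriticalPhenomena (graphBall graphBall_finite mem_graphBall_self graphBall_mono)
open BoxProdZ2 (ballFin mem_ballFin card_ballFin_le)
open Skel (winGraph winGraph_adj winLevel mem_winLevel_iff winLevel_monotone winLevel_subset_graphBall winLData winLData_X KitGeom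
  winGraphIn winGraphIn_adj winLevelIn mem_winLevelIn_iff winLevelIn_monotone winLevelIn_nest winLevelIn_subset winLDataIn winLDataIn_X
  mem_outerBoundary_winIn_iff)

variable {V : Type} [DecidableEq V] (G : SimpleGraph V) [G.LocallyFinite]

/-! ## §1 The inner neighbour of an `Ω`-contact -/

variable {G} in
/-- **An inner neighbour of `x` in the habitat window `WinIn Ω P`**: a `G`-neighbour of `x` in `Ω` with skeleton coordinate in `P` (a
classical choice; `x` itself if there is none). [cite: KozmaNitzan2024, §4 p. 19 (the edge behind a contact)] -/
def inNbrIn (Φ : PlanarSkeletonConc G) (Ω : Finset V) (P : Finset (Site 2)) (x : V) : V :=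
  if h : ∃ y, G.Adj x y ∧ y ∈ Ω ∧ Φ.φ y ∈ P then Classical.choose h else x

variable {G} in
/-- Specification of `inNbrIn` at an outer-boundary vertex of `WinIn Ω P` in `winGraphIn G Ω`: adjacent to `x`, in `Ω`, coordinate in `P`.
[folklore] -/
theorem inNbrIn_spec (Φ : PlanarSkeletonConc G) {Ω : Finset V} {P : Finset (Site 2)} {x : V}
    (hx : x ∈ outerBoundary (winGraphIn G Ω) (Φ.WinIn Ω P)) :
    G.Adj x (inNbrIn Φ Ω P x) ∧ inNbrIn Φ Ω P x ∈ Ω ∧ Φ.φ (inNbrIn Φ Ω P x) ∈ P := by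
  have h := ((mem_outerBoundary_winIn_iff Φ).1 hx).2.2
  rw [inNbrIn, dif_pos h]
  exact Classical.choose_spec h

variable {G} in
/-- The inner neighbour of an `Ω`-contact of level `j` lies in the level `winLevelIn Φ Ω lo hi j`. [folklore] -/
theorem inNbrIn_mem_winLevelIn (Φ : PlanarSkeletonConc G) {Ω : Finset V} {lo hi : Site 2} {j : ℕ} {x : V}
    (hx : x ∈ outerBoundary (winGraphIn G Ω) (winLevelIn Φ Ω lo hi j)) :
    inNbrIn Φ Ω (Finset.Icc (lo - (j : Site 2)) (hi + (j : Site 2))) x ∈ winLevelIn Φ Ω lo hi j := by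
  have h := inNbrIn_spec Φ (P := Finset.Icc (lo - (j : Site 2)) (hi + (j : Site 2))) hx
  exact (mem_winLevelIn_iff Φ).2 ⟨h.2.1, h.2.2⟩

variable {G}
variable (Φ : PlanarSkeletonConc G)

/-! ## §2 The kit hypotheses and the Step-III data over the habitat window graph -/

/-- **The hypotheses on a seed geometry at the window level `j` over `Ω`** (`K = ∂^{out}_{winGraphIn G Ω} B⟨j⟩`, `B⟨j⟩ = winLevelIn Φ Ω lo hi j`):
the fields of `SkelI.KitOK` with the habitat levels. [cite: KozmaNitzan2024, §4 p. 19 (Step III)] -/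
structure KitOKHab (Ω : Finset V) (lo hi : Site 2) (j rs cS cU : ℕ) (κ : KitGeom V) : Prop where
  adj : ∀ x ∈ outerBoundary (winGraphIn G Ω) (winLevelIn Φ Ω lo hi j), G.Adj x (κ.y x)
  y_mem : ∀ x ∈ outerBoundary (winGraphIn G Ω) (winLevelIn Φ Ω lo hi j), κ.y x ∈ κ.S x
  S_sub : ∀ x ∈ outerBoundary (winGraphIn G Ω) (winLevelIn Φ Ω lo hi j), κ.S x ⊆ winLevelIn Φ Ω lo hi j
  U_sub : ∀ x ∈ outerBoundary (winGraphIn G Ω) (winLevelIn Φ Ω lo hi j), κ.U x ⊆ winLevelIn Φ Ω lo hi j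
  S_ball : ∀ x ∈ outerBoundary (winGraphIn G Ω) (winLevelIn Φ Ω lo hi j), ∀ v ∈ κ.S x, v ∈ graphBall G x rs
  U_ball : ∀ x ∈ outerBoundary (winGraphIn G Ω) (winLevelIn Φ Ω lo hi j), ∀ u ∈ κ.U x, u ∈ graphBall G x rs
  S_path : ∀ x ∈ outerBoundary (winGraphIn G Ω) (winLevelIn Φ Ω lo hi j), ∀ v ∈ κ.S x, PathIn G (↑(κ.S x) : Set V) (κ.y x) v
  U_adj : ∀ x ∈ outerBoundary (winGraphIn G Ω) (winLevelIn Φ Ω lo hi j), ∀ u ∈ κ.U x, u ∈ κ.S x ∨ ∃ v ∈ κ.S x, G.Adj v u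
  S_card : ∀ x ∈ outerBoundary (winGraphIn G Ω) (winLevelIn Φ Ω lo hi j), (κ.S x).card ≤ cS
  U_card : ∀ x ∈ outerBoundary (winGraphIn G Ω) (winLevelIn Φ Ω lo hi j), (κ.U x).card ≤ cU

/-- **The seed data of the window level `j` over `Ω`**: candidate contacts = outer boundary of `B⟨j⟩` in `winGraphIn G Ω`, seeds `kitSeed`,
faces `κ.U`, greedy selection of `k` contacts pairwise at graph distance `> 2 rs` among `N = k (Δ+1)^{2 rs}`, seed bound `1 + Δ cS + cS cU`
(the data of `SkelI.kitSData` with the habitat contacts). [cite: KozmaNitzan2024, §4 p. 19 (Step III)] -/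
def kitSDataHab (Ω : Finset V) (lo hi : Site 2) (j : ℕ) (κ : KitGeom V) (rs cS cU k : ℕ) : SData V where
  K := outerBoundary (winGraphIn G Ω) (winLevelIn Φ Ω lo hi j)
  seed := kitSeed G κ
  face := κ.U
  pick := apartSel (fun x => ballFin G x (2 * rs)) (Skel.center_mem_ballFin' rs) (Skel.ballFin_symm' rs) (Skel.pow_succ_pos' Φ.Δ rs)
    (fun x => card_ballFin_le G Φ.degree_le x (2 * rs)) k
  N := k * (Φ.Δ + 1) ^ (2 * rs)
  k := k
  sB := 1 + Φ.Δ * cS + cS * cU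

/-- The candidate contacts of `kitSDataHab`. [folklore] -/
@[simp] theorem kitSDataHab_K (Ω : Finset V) (lo hi : Site 2) (j : ℕ) (κ : KitGeom V) (rs cS cU k : ℕ) :
    (kitSDataHab Φ Ω lo hi j κ rs cS cU k).K = outerBoundary (winGraphIn G Ω) (winLevelIn Φ Ω lo hi j) := rfl

/-- The seeds of `kitSDataHab`. [folklore] -/
@[simp] theorem kitSDataHab_seed (Ω : Finset V) (lo hi : Site 2) (j : ℕ) (κ : KitGeom V) (rs cS cU k : ℕ) :
    (kitSDataHab Φ Ω lo hi j κ rs cS cU k).seed = kitSeed G κ := rfl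

/-- The faces of `kitSDataHab`. [folklore] -/
@[simp] theorem kitSDataHab_face (Ω : Finset V) (lo hi : Site 2) (j : ℕ) (κ : KitGeom V) (rs cS cU k : ℕ) :
    (kitSDataHab Φ Ω lo hi j κ rs cS cU k).face = κ.U := rfl

/-- The selection of `kitSDataHab` is a subset. [folklore] -/
theorem kitSDataHab_pick_subset (Ω : Finset V) (lo hi : Site 2) (j : ℕ) (κ : KitGeom V) (rs cS cU k : ℕ) (c : Finset V) :
    (kitSDataHab Φ Ω lo hi j κ rs cS cU k).pick c ⊆ c :=
  apartSel_subset (fun x => ballFin G x (2 * rs)) (Skel.center_mem_ballFin' rs) (Skel.ballFin_symm' rs) (Skel.pow_succ_pos' Φ.Δ rs)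
    (fun x => card_ballFin_le G Φ.degree_le x (2 * rs)) k c

/-- The selection of `kitSDataHab` on large sets: `k` elements, pairwise at graph distance `> 2 rs`. [folklore] -/
theorem kitSDataHab_pick_spec (Ω : Finset V) (lo hi : Site 2) (j : ℕ) (κ : KitGeom V) (rs cS cU k : ℕ) {c : Finset V}
    (hc : k * (Φ.Δ + 1) ^ (2 * rs) ≤ c.card) :
    ((kitSDataHab Φ Ω lo hi j κ rs cS cU k).pick c).card = k ∧
      ∀ x ∈ (kitSDataHab Φ Ω lo hi j κ rs cS cU k).pick c, ∀ x' ∈ (kitSDataHab Φ Ω lo hi j κ rs cS cU k).pick c,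
        x ≠ x' → x' ∉ ballFin G x (2 * rs) :=
  have h := apartSel_spec (fun x => ballFin G x (2 * rs)) (Skel.center_mem_ballFin' rs) (Skel.ballFin_symm' rs) (Skel.pow_succ_pos' Φ.Δ rs)
    (fun x => card_ballFin_le G Φ.degree_le x (2 * rs)) hc
  ⟨h.2.1, h.2.2⟩

section SHyp

variable {Φ}
variable {Ω : Finset V} {lo hi : Site 2} {j rs cS cU : ℕ} {κ : KitGeom V}
variable (hκ : KitOKHab Φ Ω lo hi j rs cS cU κ)
include hκ

/-- **The Step-III axioms for the seed kit of a window level over `Ω`**: `KNLevels.SHyp L j (kitSDataHab …)` for every habitat window level data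
`L = winLDataIn Φ Ω lo hi o Sfin` (the proof of `SkelI.shyp_kit` with `winGraphIn`-edges: both endpoints of a seed edge lie in `Ω`, the contact by
`K ⊆ Ω`, the others by `S_sub` / `U_sub`). [cite: KozmaNitzan2024, §4 p. 19 (Step III)] -/
theorem shyp_kitHab (o : V) (Sfin : Finset V) (k : ℕ) :
    SHyp (winLDataIn Φ Ω lo hi o Sfin) j (kitSDataHab Φ Ω lo hi j κ rs cS cU k) where
  Kont_sub ω := by
    rw [kitSDataHab_K]
    exact (winLDataIn Φ Ω lo hi o Sfin).Kont_subset j ω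
  edge x hx e he := by
    rw [kitSDataHab_K] at hx
    rw [kitSDataHab_seed] at he
    have hx' : x ∈ outerBoundary (winGraphIn G Ω) (Φ.WinIn Ω (Finset.Icc (lo - (j : Site 2)) (hi + (j : Site 2)))) := hx
    have hΩ : ∀ z ∈ e, z ∈ Ω := by
      intro z hz
      rcases (exists_mem_of_mem_kitSeed κ he).2 z hz with rfl | rfl | h | h
      · exact ((mem_outerBoundary_winIn_iff Φ).1 hx').1
      · exact winLevelIn_subset Φ Ω lo hi j (hκ.S_sub _ hx (hκ.y_mem _ hx))
      · exact winLevelIn_subset Φ Ω lo hi j (hκ.S_sub _ hx h)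
      · exact winLevelIn_subset Φ Ω lo hi j (hκ.U_sub _ hx h)
    have hG : e ∈ G.edgeSet := by
      rcases mem_kitSeed_cases κ he with rfl | h | ⟨v, -, u, -, hvu, rfl⟩
      · exact (SimpleGraph.mem_edgeSet (G := G)).2 (hκ.adj _ hx)
      · exact ((mem_edgesIn_iff).1 h).1
      · exact (SimpleGraph.mem_edgeSet (G := G)).2 hvu
    induction e using Sym2.ind with
    | h a b =>
      rw [SimpleGraph.mem_edgeSet] at hG ⊢
      exact (winGraphIn_adj G).2 ⟨hG, hΩ a (Sym2.mem_mk_left a b), hΩ b (Sym2.mem_mk_right a b)⟩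
  within x hx e he z hz := by
    rw [kitSDataHab_K] at hx
    rw [kitSDataHab_seed] at he
    rw [winLDataIn_X]
    have hmono := winLevelIn_monotone Φ Ω lo hi (Nat.le_succ j)
    rcases (exists_mem_of_mem_kitSeed κ he).2 z hz with rfl | rfl | h | h
    · exact winLevelIn_nest Φ Ω lo hi j hx
    · exact hmono (hκ.S_sub _ hx (hκ.y_mem _ hx))
    · exact hmono (hκ.S_sub _ hx h)
    · exact hmono (hκ.U_sub _ hx h)
  touch x hx e he := by
    rw [kitSDataHab_K] at hx
    rw [kitSDataHab_seed] at he
    rw [winLDataIn_X]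
    rcases mem_kitSeed_cases κ he with rfl | h | ⟨v, hv, u, -, -, rfl⟩
    · exact ⟨κ.y x, Sym2.mem_mk_right _ _, hκ.S_sub _ hx (hκ.y_mem _ hx)⟩
    · induction e using Sym2.ind with
      | h a b => exact ⟨a, Sym2.mem_mk_left a b, hκ.S_sub _ hx (((mem_edgesIn_iff).1 h).2 a (Sym2.mem_mk_left a b))⟩
    · exact ⟨v, Sym2.mem_mk_left _ _, hκ.S_sub _ hx hv⟩
  card_le x hx := by
    rw [kitSDataHab_K] at hx
    simp only [kitSDataHab_seed, kitSeed]
    calc ({s(x, κ.y x)} ∪ edgesIn G (κ.S x) ∪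
            ((κ.S x ×ˢ κ.U x).filter fun q => G.Adj q.1 q.2).image fun q => s(q.1, q.2)).card
        ≤ ({s(x, κ.y x)} ∪ edgesIn G (κ.S x)).card +
            (((κ.S x ×ˢ κ.U x).filter fun q => G.Adj q.1 q.2).image fun q => s(q.1, q.2)).card := Finset.card_union_le _ _
      _ ≤ (1 + Φ.Δ * cS) + cS * cU := by
          refine Nat.add_le_add ((Finset.card_union_le _ _).trans (Nat.add_le_add (by simp) ?_)) ?_
          · have hE : (edgesIn G (κ.S x)).card ≤ Φ.Δ * (κ.S x).card :=
              calc (edgesIn G (κ.S x)).card ≤ (edgesTouching G (κ.S x)).card :=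
                    Finset.card_le_card (edgesIn_subset_edgesTouching _)
                _ ≤ ∑ v ∈ κ.S x, (G.incidenceFinset v).card := Finset.card_biUnion_le
                _ ≤ ∑ _v ∈ κ.S x, Φ.Δ := Finset.sum_le_sum fun v _ => by
                    rw [SimpleGraph.card_incidenceFinset_eq_degree]; exact Φ.degree_le v
                _ = Φ.Δ * (κ.S x).card := by rw [Finset.sum_const, smul_eq_mul, mul_comm]
            exact hE.trans (Nat.mul_le_mul_left _ (hκ.S_card _ hx))
          · calc (((κ.S x ×ˢ κ.U x).filter fun q => G.Adj q.1 q.2).image fun q => s(q.1, q.2)).card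
                ≤ ((κ.S x ×ˢ κ.U x).filter fun q => G.Adj q.1 q.2).card := Finset.card_image_le
              _ ≤ (κ.S x ×ˢ κ.U x).card := Finset.card_filter_le _ _
              _ = (κ.S x).card * (κ.U x).card := Finset.card_product _ _
              _ ≤ cS * cU := Nat.mul_le_mul (hκ.S_card _ hx) (hκ.U_card _ hx)
      _ = 1 + Φ.Δ * cS + cS * cU := rfl
  conn x hx ω hω u hu := by
    rw [kitSDataHab_K] at hx
    rw [kitSDataHab_seed] at hω
    rw [kitSDataHab_face] at hu
    have h1 : (openGraph ω).Adj x (κ.y x) := by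
      rw [openGraph_adj]
      exact ⟨hω (Finset.mem_coe.2 (contactEdge_mem_kitSeed κ x)), (hκ.adj _ hx).ne⟩
    have hE : ∀ e ∈ edgesIn G (κ.S x), e ∈ ω := fun e he => hω (Finset.mem_coe.2 (edgesIn_subset_kitSeed κ x he))
    have h2 : ∀ v ∈ κ.S x, (openGraph ω).Reachable (κ.y x) v := by
      intro v hv
      obtain ⟨ha, hp⟩ := hκ.S_path _ hx v hv
      clear hv
      induction hp with
      | refl => exact SimpleGraph.Reachable.refl _
      | @tail b c hab hc ih =>
        have hb : b ∈ (↑(κ.S x) : Set V) := (show PathIn G (↑(κ.S x) : Set V) (κ.y x) b from ⟨ha, hab⟩).right_mem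
        refine ih.trans (SimpleGraph.Adj.reachable ?_)
        rw [openGraph_adj]
        refine ⟨hE _ ?_, hc.1.ne⟩
        rw [mem_edgesIn_iff]
        refine ⟨(SimpleGraph.mem_edgeSet (G := G)).2 hc.1, fun w hw => ?_⟩
        rcases Sym2.mem_iff.1 hw with rfl | rfl
        · exact Finset.mem_coe.1 hb
        · exact Finset.mem_coe.1 hc.2
    rcases hκ.U_adj _ hx u hu with huS | ⟨v, hv, hvu⟩
    · exact h1.reachable.trans (h2 u huS)
    · have h3 : (openGraph ω).Adj v u := by
        rw [openGraph_adj]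
        exact ⟨hω (Finset.mem_coe.2 (rung_mem_kitSeed κ hv hu hvu)), hvu.ne⟩
      exact h1.reachable.trans ((h2 v hv).trans h3.reachable)
  pick_sub c := kitSDataHab_pick_subset Φ Ω lo hi j κ rs cS cU k c
  pick_card c hcK hc := (kitSDataHab_pick_spec Φ Ω lo hi j κ rs cS cU k hc).1
  pick_disj c hcK hc := by
    rw [kitSDataHab_K] at hcK
    have hball : ∀ x ∈ outerBoundary (winGraphIn G Ω) (winLevelIn Φ Ω lo hi j), ∀ e ∈ kitSeed G κ x, ∀ z ∈ e,
        z ∈ graphBall G x rs := by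
      intro x hx e he z hz
      rcases (exists_mem_of_mem_kitSeed κ he).2 z hz with rfl | rfl | h | h
      · exact mem_graphBall_self G _ rs
      · exact hκ.S_ball _ hx _ (hκ.y_mem _ hx)
      · exact hκ.S_ball _ hx _ h
      · exact hκ.U_ball _ hx _ h
    refine pairwiseDisjoint_apartSel (fun x => ballFin G x (2 * rs)) (Skel.center_mem_ballFin' rs) (Skel.ballFin_symm' rs)
      (Skel.pow_succ_pos' Φ.Δ rs) (fun x => card_ballFin_le G Φ.degree_le x (2 * rs)) hc fun x hx x' hx' hfar => ?_
    rw [Finset.disjoint_left]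
    intro e he he'
    induction e using Sym2.ind with
    | h a b =>
      have ha := hball x (hcK hx) _ he a (Sym2.mem_mk_left a b)
      have ha' := hball x' (hcK hx') _ he' a (Sym2.mem_mk_left a b)
      refine hfar ((mem_ballFin G).2 ?_)
      have h := BoxProdZ2.mem_graphBall_add G ha ((BoxProdZ2.mem_graphBall_comm G).1 ha')
      rwa [two_mul]

end SHyp

/-! ## §3 Padding a plain kit geometry -/

/-- **The padded kit geometry**: the plain kit geometry `κ` of the window `(w₀, R)` on the plain contacts
`K_plain = ∂^{out}_{winGraph G w₀ R} winLevel Φ w₀ R lo hi j`, and the far remedy `y = S = U = {inNbrIn x}` elsewhere.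
[cite: KozmaNitzan2024, §4 p. 19 (Step III)] -/
def habPad (Ω : Finset V) (w₀ : V) (R : ℕ) (lo hi : Site 2) (j : ℕ) (κ : KitGeom V) : KitGeom V where
  y := fun x => if x ∈ outerBoundary (winGraph G w₀ R) (winLevel Φ w₀ R lo hi j) then κ.y x
    else inNbrIn Φ Ω (Finset.Icc (lo - (j : Site 2)) (hi + (j : Site 2))) x
  S := fun x => if x ∈ outerBoundary (winGraph G w₀ R) (winLevel Φ w₀ R lo hi j) then κ.S x
    else {inNbrIn Φ Ω (Finset.Icc (lo - (j : Site 2)) (hi + (j : Site 2))) x}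
  U := fun x => if x ∈ outerBoundary (winGraph G w₀ R) (winLevel Φ w₀ R lo hi j) then κ.U x
    else {inNbrIn Φ Ω (Finset.Icc (lo - (j : Site 2)) (hi + (j : Site 2))) x}

section Pad

variable {Φ}
variable {Ω : Finset V} {w₀ : V} {R : ℕ} {lo hi : Site 2} {j : ℕ} {κ : KitGeom V}

/-- On a plain contact the padded geometry is the plain one. [folklore] -/
theorem habPad_of_mem {x : V} (hx : x ∈ outerBoundary (winGraph G w₀ R) (winLevel Φ w₀ R lo hi j)) :
    (habPad Φ Ω w₀ R lo hi j κ).y x = κ.y x ∧ (habPad Φ Ω w₀ R lo hi j κ).S x = κ.S x ∧ (habPad Φ Ω w₀ R lo hi j κ).U x = κ.U x := by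
  simp only [habPad, if_pos hx, and_self]

/-- Off the plain contacts the padded geometry is the far remedy `{inNbrIn x}`. [folklore] -/
theorem habPad_of_not_mem {x : V} (hx : x ∉ outerBoundary (winGraph G w₀ R) (winLevel Φ w₀ R lo hi j)) :
    (habPad Φ Ω w₀ R lo hi j κ).y x = inNbrIn Φ Ω (Finset.Icc (lo - (j : Site 2)) (hi + (j : Site 2))) x ∧
      (habPad Φ Ω w₀ R lo hi j κ).S x = {inNbrIn Φ Ω (Finset.Icc (lo - (j : Site 2)) (hi + (j : Site 2))) x} ∧
      (habPad Φ Ω w₀ R lo hi j κ).U x = {inNbrIn Φ Ω (Finset.Icc (lo - (j : Site 2)) (hi + (j : Site 2))) x} := by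
  simp only [habPad, if_neg hx, and_self]

/-- **An `Ω`-contact of level `j` within depth `R - 1` of `w₀` is a plain contact** of the window `(w₀, R)`: its inner `Ω`-neighbour lies in
`B_G(w₀, R)` with coordinate in the level box. [folklore] -/
theorem mem_plain_of_mem_graphBall {x : V} (hx : x ∈ outerBoundary (winGraphIn G Ω) (winLevelIn Φ Ω lo hi j)) {d : ℕ}
    (hd : d + 1 ≤ R) (hxd : x ∈ graphBall G w₀ d) : x ∈ outerBoundary (winGraph G w₀ R) (winLevel Φ w₀ R lo hi j) := by
  have hx' : x ∈ outerBoundary (winGraphIn G Ω) (Φ.WinIn Ω (Finset.Icc (lo - (j : Site 2)) (hi + (j : Site 2)))) := hx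
  obtain ⟨-, hxP, y, hxy, -, hyP⟩ := (mem_outerBoundary_winIn_iff Φ).1 hx'
  have goal : x ∈ outerBoundary (winGraph G w₀ R) (Φ.Win w₀ (Finset.Icc (lo - (j : Site 2)) (hi + (j : Site 2))) R) :=
    (mem_outerBoundary_win_iff Φ).2 ⟨graphBall_mono G w₀ (by omega) hxd, hxP, y, hxy,
      graphBall_mono G w₀ hd (BoxProdZ2.mem_graphBall_succ_of_adj G hxd hxy), hyP⟩
  exact goal

/-- **The inner neighbour of a padded (non-plain) `Ω`-contact lies at depth `≥ R` from `w₀`**: `inNbrIn x ∉ B_G(w₀, d)` for `d + 1 ≤ R`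
(so a rim target containing the level-`j` vertices of `Ω` beyond depth `R - 1` contains the padded faces). [folklore] -/
theorem inNbrIn_not_mem_graphBall {x : V} (hx : x ∈ outerBoundary (winGraphIn G Ω) (winLevelIn Φ Ω lo hi j))
    (hxn : x ∉ outerBoundary (winGraph G w₀ R) (winLevel Φ w₀ R lo hi j)) {d : ℕ} (hd : d + 1 ≤ R) :
    inNbrIn Φ Ω (Finset.Icc (lo - (j : Site 2)) (hi + (j : Site 2))) x ∉ graphBall G w₀ d := by
  intro hyd
  have hx' : x ∈ outerBoundary (winGraphIn G Ω) (Φ.WinIn Ω (Finset.Icc (lo - (j : Site 2)) (hi + (j : Site 2)))) := hx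
  obtain ⟨-, hxP, -⟩ := (mem_outerBoundary_winIn_iff Φ).1 hx'
  obtain ⟨hadj, -, hyP⟩ := inNbrIn_spec Φ hx'
  refine hxn ?_
  have goal : x ∈ outerBoundary (winGraph G w₀ R) (Φ.Win w₀ (Finset.Icc (lo - (j : Site 2)) (hi + (j : Site 2))) R) :=
    (mem_outerBoundary_win_iff Φ).2 ⟨graphBall_mono G w₀ hd (BoxProdZ2.mem_graphBall_succ_of_adj G hyd hadj.symm), hxP, _, hadj,
      graphBall_mono G w₀ (by omega) hyd, hyP⟩
  exact goal

omit [DecidableEq V] in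
/-- A plain level vertex lies in the habitat level when `Ω` is full over the level box. [folklore] -/
theorem winLevel_subset_winLevelIn (hfull : winLevel Φ w₀ R lo hi j ⊆ Ω) : winLevel Φ w₀ R lo hi j ⊆ winLevelIn Φ Ω lo hi j :=
  fun _ hv => (mem_winLevelIn_iff Φ).2 ⟨hfull hv, ((mem_winLevel_iff Φ).1 hv).2⟩

/-- **Padding preserves the kit hypotheses**: a plain kit `KitOK Φ w₀ R lo hi j rs cS cU κ` with `Ω` full over the level box
(`winLevel Φ w₀ R lo hi j ⊆ Ω`) and `1 ≤ rs, cS, cU` gives `KitOKHab Φ Ω lo hi j rs cS cU (habPad Φ Ω w₀ R lo hi j κ)` — plain contacts take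
every field from `KitOK` (the two containments through `hfull`), padded contacts the singleton fields. [cite: KozmaNitzan2024, §4 p. 19 (Step III)] -/
theorem kitOKHab_pad {rs cS cU : ℕ} (hκ : KitOK Φ w₀ R lo hi j rs cS cU κ) (hfull : winLevel Φ w₀ R lo hi j ⊆ Ω) (hrs : 1 ≤ rs)
    (hcS : 1 ≤ cS) (hcU : 1 ≤ cU) : KitOKHab Φ Ω lo hi j rs cS cU (habPad Φ Ω w₀ R lo hi j κ) := by
  have hsub := winLevel_subset_winLevelIn (Φ := Φ) hfull
  -- the far remedy at a padded contact
  have hfar : ∀ x ∈ outerBoundary (winGraphIn G Ω) (winLevelIn Φ Ω lo hi j), x ∉ outerBoundary (winGraph G w₀ R) (winLevel Φ w₀ R lo hi j) →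
      G.Adj x (inNbrIn Φ Ω (Finset.Icc (lo - (j : Site 2)) (hi + (j : Site 2))) x) ∧
        inNbrIn Φ Ω (Finset.Icc (lo - (j : Site 2)) (hi + (j : Site 2))) x ∈ winLevelIn Φ Ω lo hi j ∧
        inNbrIn Φ Ω (Finset.Icc (lo - (j : Site 2)) (hi + (j : Site 2))) x ∈ graphBall G x rs := by
    intro x hx _
    have hx' : x ∈ outerBoundary (winGraphIn G Ω) (Φ.WinIn Ω (Finset.Icc (lo - (j : Site 2)) (hi + (j : Site 2)))) := hx
    have h := inNbrIn_spec Φ hx'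
    exact ⟨h.1, inNbrIn_mem_winLevelIn Φ hx,
      graphBall_mono G x hrs (BoxProdZ2.mem_graphBall_succ_of_adj G (mem_graphBall_self G x 0) h.1)⟩
  constructor
  · intro x hx
    by_cases hp : x ∈ outerBoundary (winGraph G w₀ R) (winLevel Φ w₀ R lo hi j)
    · rw [(habPad_of_mem hp).1]; exact hκ.adj _ hp
    · rw [(habPad_of_not_mem hp).1]; exact (hfar x hx hp).1
  · intro x hx
    by_cases hp : x ∈ outerBoundary (winGraph G w₀ R) (winLevel Φ w₀ R lo hi j)
    · rw [(habPad_of_mem hp).1, (habPad_of_mem hp).2.1]; exact hκ.y_mem _ hp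
    · rw [(habPad_of_not_mem hp).1, (habPad_of_not_mem hp).2.1]; exact Finset.mem_singleton_self _
  · intro x hx
    by_cases hp : x ∈ outerBoundary (winGraph G w₀ R) (winLevel Φ w₀ R lo hi j)
    · rw [(habPad_of_mem hp).2.1]; exact (hκ.S_sub _ hp).trans hsub
    · rw [(habPad_of_not_mem hp).2.1]; exact Finset.singleton_subset_iff.2 (hfar x hx hp).2.1
  · intro x hx
    by_cases hp : x ∈ outerBoundary (winGraph G w₀ R) (winLevel Φ w₀ R lo hi j)
    · rw [(habPad_of_mem hp).2.2]; exact (hκ.U_sub _ hp).trans hsub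
    · rw [(habPad_of_not_mem hp).2.2]; exact Finset.singleton_subset_iff.2 (hfar x hx hp).2.1
  · intro x hx v hv
    by_cases hp : x ∈ outerBoundary (winGraph G w₀ R) (winLevel Φ w₀ R lo hi j)
    · rw [(habPad_of_mem hp).2.1] at hv; exact hκ.S_ball _ hp _ hv
    · rw [(habPad_of_not_mem hp).2.1, Finset.mem_singleton] at hv; rw [hv]; exact (hfar x hx hp).2.2
  · intro x hx u hu
    by_cases hp : x ∈ outerBoundary (winGraph G w₀ R) (winLevel Φ w₀ R lo hi j)
    · rw [(habPad_of_mem hp).2.2] at hu; exact hκ.U_ball _ hp _ hu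
    · rw [(habPad_of_not_mem hp).2.2, Finset.mem_singleton] at hu; rw [hu]; exact (hfar x hx hp).2.2
  · intro x hx v hv
    by_cases hp : x ∈ outerBoundary (winGraph G w₀ R) (winLevel Φ w₀ R lo hi j)
    · rw [(habPad_of_mem hp).2.1] at hv ⊢; rw [(habPad_of_mem hp).1]; exact hκ.S_path _ hp _ hv
    · rw [(habPad_of_not_mem hp).2.1] at hv ⊢; rw [(habPad_of_not_mem hp).1]
      rw [Finset.mem_singleton] at hv; rw [hv]
      exact PathIn.refl (by simp)
  · intro x hx u hu
    by_cases hp : x ∈ outerBoundary (winGraph G w₀ R) (winLevel Φ w₀ R lo hi j)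
    · rw [(habPad_of_mem hp).2.2] at hu; rw [(habPad_of_mem hp).2.1]; exact hκ.U_adj _ hp _ hu
    · rw [(habPad_of_not_mem hp).2.2] at hu; rw [(habPad_of_not_mem hp).2.1]; exact Or.inl hu
  · intro x hx
    by_cases hp : x ∈ outerBoundary (winGraph G w₀ R) (winLevel Φ w₀ R lo hi j)
    · rw [(habPad_of_mem hp).2.1]; exact hκ.S_card _ hp
    · rw [(habPad_of_not_mem hp).2.1, Finset.card_singleton]; exact hcS
  · intro x hx
    by_cases hp : x ∈ outerBoundary (winGraph G w₀ R) (winLevel Φ w₀ R lo hi j)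
    · rw [(habPad_of_mem hp).2.2]; exact hκ.U_card _ hp
    · rw [(habPad_of_not_mem hp).2.2, Finset.card_singleton]; exact hcU

/-- **The Step-III axioms of the padded kit over the habitat window graph** (`shyp_kitHab ∘ kitOKHab_pad`).
[cite: KozmaNitzan2024, §4 p. 19 (Step III)] -/
theorem shyp_habPad {rs cS cU : ℕ} (hκ : KitOK Φ w₀ R lo hi j rs cS cU κ) (hfull : winLevel Φ w₀ R lo hi j ⊆ Ω) (hrs : 1 ≤ rs)
    (hcS : 1 ≤ cS) (hcU : 1 ≤ cU) (o : V) (Sfin : Finset V) (k : ℕ) :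
    SHyp (winLDataIn Φ Ω lo hi o Sfin) j (kitSDataHab Φ Ω lo hi j (habPad Φ Ω w₀ R lo hi j κ) rs cS cU k) :=
  shyp_kitHab (kitOKHab_pad hκ hfull hrs hcS hcU) o Sfin k

end Pad

end SkelI
end Transplant
end Summit.CriticalPhenomena.PercolationContinuityZ3.Theorems

end
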